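import Summits.ValiantsHypothesis.ValiantsHypothesis.Theorems.FifoMatchingNNDivisionHardExactIsVirtual
import HarnessLib

/-!
# POVERTY / JUNTA BARRIER for located laws — the point passenger
# (crux `NNDivisionHard`, stmt-ValiantsHypothesis-21181; route `FifoMatching`; val-idea-41 g5, W7, lens REFUTE)

THEOREMS PORT (val-lit-p5 g15, desk ruling #449, 2026-08-29) of the crux workfile `Cruxes/NNDivisionHard/PovertyBarrier41.lean` rev 2 @a57f5cfee974
(sha16 8a30150d7d9a0a5f; kernel of record crit-9 V#126a / V#128c) — declarations VERBATIM, re-namespaced to `…Theorems.FifoMatching.PovertyBarrier`;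
imports unchanged (✓ `…ExactIsVirtual` only); seven lint docstrings added (marked `[port lint docstring]`), declaration texts unchanged.  Credit: val-idea-41 g5.

Original header.  Crux workfile (kernel food; elaborates against the TREE frame `Theorems/FifoMatchingNNDivisionHardRowFamilies.lean` — `RowFamily`,
`RowFamily.Law`, `T` — and `Theorems/FifoMatchingNNDivisionHardExactIsVirtual.lean`).  A NEGATIVE design test for intermediate located laws,
complementary to the pencil collapse (`PencilCollapse41.lean`): there, TOO RICH a family (an infinitesimal exact pencil) makes the law
COR-VIRTUAL-strong; here, TOO POOR a family makes the law FALSE outright.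

**POVERTY BARRIER** (`law_false_of_cheap_corSlack`).  In `F.Law` the passenger may be a POINT (`K = 0`, `q ≡ 0`, `xc = 1 ≤ r` for every
`r ≥ 1`): the located maxima vanish and the located slack IS the family's own COR-slack block `β_a − ⟨ρ_a, x_b⟩`.  Hence: if for some fixed
`c` and infinitely many `n` that block factors nonnegatively through `r + 1 ≤ T c n + 1` slots, the law is FALSE.  A proper intermediate
law must itself certify `rank₊(own COR-slack block) > T c n` for EVERY `c` — super-quasi-polynomial nonnegative rank.

**JUNTA BARRIER** (`law_false_of_junta`).  If every row's slack `b ↦ β_a − ⟨ρ_a, x_b⟩` at order `n` depends on `𝟙_b` only through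
`b ∩ S_a` for some `|S_a| ≤ (log₂ n)^d` (a polylog-JUNTA; the right-hand side is irrelevant), then the block factors through the
`(2n+1)^{(log₂ n)^d} ≤ T (d+2) n` literal-list slots `Fin w → Option (Fin n × Bool)` (`cheapCorSlack_of_junta`, `junta_budget`) and the
law is FALSE.  Instance (`law_false_of_sparse_rows`): any family whose functionals are `udRow a + flat W` with `a` and the vertex support
of `W` inside a set of `≤ (log₂ n)^d` coordinates — all SPARSE EXACT TILT ALPHABETS AT SMALL CLIQUES, whatever the scales and the rhs.
This kills in advance the «discrete sparse-tilt ladder `L_{s,η}` at singleton cliques» floated in `ExactIsVirtual41.md` §3 /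
`PencilCollapse41.md` §4 for every `s ≤ polylog`, and every clique-row family with `|a| ≤ polylog` (the full clique-row law needed the
blind cube `Q♮`, ✓ p671347, because `(1 − |a∩b|)²` over ALL cliques is NOT cheap).

ENEMY CONSTRAINT (§5, `cheapOn_argmax_class`): in any instance of the law's hypothesis the own COR-slack block of every ARGMAX CLASS
`{a : ⟨ρ_a, q_j⟩ = m_a}` factors through the same `r + 1` slots (the point = one class); a refuting passenger must shatter an expensive own
block into cheap argmax classes and pay the off-class differences.

DESIGN RULE v3 (proposed; endorsed crit-9 V#122a): a proper intermediate located law has (i) NO infinitesimal exact pencil at any clique (else COR-VIRTUAL), and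
(ii) rows touching `(log₂ n)^{ω(1)}` coordinates of `𝟙_b` with an own COR-slack block of super-quasi-polynomial `rank₊` (else FALSE by a point).

HONEST LABEL: negative / census tool; closes NO item; 21181, `CorVirtualHardN`, `ExactPencilLaw` OPEN; VP ≠ VNP is NOT proved.
-/

set_option autoImplicit false
set_option linter.dupNamespace false
set_option linter.unusedVariables false

noncomputable section

open Matrix Finset

namespace Summit.ValiantsHypothesis.ValiantsHypothesis.Theorems.FifoMatching.PovertyBarrier

open Literature.Barriers.PneNP (HasEFOfSize hasEFOfSize_convexHull_finset)
open Literature.Combinatorics.Optimization.FixedSizePsdRank (Cube bvec flat vecOuter corPolytope bvec_zero_or_one)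
open Summit.ValiantsHypothesis.ValiantsHypothesis.Theorems.FifoMatching.XcDivision (udInd udPt udRow udMat ud_data)
open Summit.ValiantsHypothesis.ValiantsHypothesis.Theorems.FifoMatching.LocatedRows (T CorVirtualHardN RowFamily)

/-! ## §1 The point passenger -/

section Point
variable {n : ℕ}

/-- a single point has an extended formulation of every size `r ≥ 1`. -/
theorem hasEFOfSize_point (x₀ : Fin (n * n) → ℝ) {r : ℕ} (hr : 1 ≤ r) :
    HasEFOfSize (convexHull ℝ (Set.range (fun _ : Fin (0 + 1) => x₀))) r := by
  classical
  have h := hasEFOfSize_convexHull_finset ({x₀} : Finset (Fin (n * n) → ℝ))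
  rw [Finset.card_singleton] at h
  have hr' : Set.range (fun _ : Fin (0 + 1) => x₀) = (({x₀} : Finset (Fin (n * n) → ℝ)) : Set _) := by
    rw [Finset.coe_singleton]
    exact Set.range_const
  rw [hr']
  exact h.of_le hr

/-- the vertices of `COR` satisfy every valid inequality: the COR-slack block is nonnegative. -/
theorem slack_nonneg (F : RowFamily) (a : F.A n) (b : Finset (Fin n)) : 0 ≤ F.β n a - F.ρ n a ⬝ᵥ udPt b := by
  have h := F.valid n a (udPt b) (subset_convexHull ℝ _ ⟨fun i => decide (i ∈ b), rfl⟩)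
  linarith

end Point

/-! ## §2 The poverty barrier -/

/-- **the family's own COR-slack block at order `n` is CHEAP**: it factors nonnegatively through the `r + 1` slots `Option (Fin r)`. -/
def CheapCorSlack (F : RowFamily) (n r : ℕ) : Prop :=
  ∃ (U : F.A n → Option (Fin r) → ℝ) (V : Finset (Fin n) → Option (Fin r) → ℝ),
    (∀ a i, 0 ≤ U a i) ∧ (∀ b i, 0 ≤ V b i) ∧ ∀ a b, F.β n a - F.ρ n a ⬝ᵥ udPt b = ∑ i, U a i * V b i

/-- ★★★ **POVERTY BARRIER.**  If for a fixed `c` and infinitely many orders `n` the family's own COR-slack block is cheap with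
`1 ≤ r ≤ T c n`, the located law of `F` is FALSE — witnessed by the POINT passenger `q ≡ 0`. -/
theorem law_false_of_cheap_corSlack (F : RowFamily) (c : ℕ)
    (h : ∀ n₀ : ℕ, ∃ n, n₀ ≤ n ∧ ∃ r : ℕ, 1 ≤ r ∧ r ≤ T c n ∧ CheapCorSlack F n r) : ¬ F.Law := by
  intro hL
  obtain ⟨n₀, hn₀⟩ := hL c
  obtain ⟨n, hn, r, hr1, hrT, U, V, hU, hV, hfac⟩ := h n₀
  have key := hn₀ n hn 0 (fun _ => 0) r (hasEFOfSize_point 0 hr1) (fun _ => 0)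
    (fun a j => by simp) (fun a => ⟨0, by simp⟩) U (fun p => V p.1) hU (fun p i => hV _ _)
    (fun a b j => by simpa using hfac a b)
  omega

/-- transport: a factorisation through any finite slot type `σ` is a `CheapCorSlack` with `r = |σ|` (the extra slot carries `0`). -/
theorem cheapCorSlack_of_fintype (F : RowFamily) (n : ℕ) {σ : Type} [Fintype σ]
    (U : F.A n → σ → ℝ) (V : Finset (Fin n) → σ → ℝ) (hU : ∀ a i, 0 ≤ U a i) (hV : ∀ b i, 0 ≤ V b i)
    (hfac : ∀ a b, F.β n a - F.ρ n a ⬝ᵥ udPt b = ∑ i, U a i * V b i) :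
    CheapCorSlack F n (Fintype.card σ) := by
  classical
  let e : σ ≃ Fin (Fintype.card σ) := Fintype.equivFin σ
  refine ⟨fun a i => i.elim 0 (fun j => U a (e.symm j)), fun b i => i.elim 0 (fun j => V b (e.symm j)), ?_, ?_, ?_⟩
  · intro a i; cases i <;> simp [hU]
  · intro b i; cases i <;> simp [hV]
  · intro a b
    rw [hfac, Fintype.sum_option]
    simp only [Option.elim_none, Option.elim_some, zero_mul, zero_add]
    exact Fintype.sum_equiv e _ _ (fun i => by simp)

/-! ## §3 The junta barrier -/

section Junta
variable {n : ℕ}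

/-- literal-list slots: `w` optional literals `(i, bit)`. -/
abbrev Slot (n w : ℕ) : Type := Fin w → Option (Fin n × Bool)

/-- There are `(2n+1)^w` literal-list slots. [port lint docstring] -/
theorem card_slot (n w : ℕ) : Fintype.card (Slot n w) = (2 * n + 1) ^ w := by
  classical
  rw [Fintype.card_fun, Fintype.card_option, Fintype.card_prod, Fintype.card_fin, Fintype.card_bool, Fintype.card_fin]
  ring

variable (w : ℕ)

/-- the code of a pattern `(S, Z)`, `Z ⊆ S`, `|S| ≤ w`: the literals `(i, [i ∈ Z])` for `i ∈ S` in increasing order, padded with `none`. -/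
def code (S Z : Finset (Fin n)) : Slot n w := fun k =>
  if h : (k : ℕ) < S.card then
    some (S.orderEmbOfFin rfl ⟨k, h⟩, decide (S.orderEmbOfFin rfl ⟨k, h⟩ ∈ Z))
  else none

/-- `b` AGREES with a slot: every listed literal holds for `𝟙_b`. -/
def Agree (b : Finset (Fin n)) (f : Slot n w) : Prop := ∀ k p, f k = some p → (p.1 ∈ b ↔ p.2 = true)

/-- Every member of `S` is hit by the order embedding `Fin S.card ↪o S`. [port lint docstring] -/
theorem exists_index_of_mem {S : Finset (Fin n)} {i : Fin n} (hi : i ∈ S) : ∃ j : Fin S.card, S.orderEmbOfFin rfl j = i := by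
  have : i ∈ Set.range (S.orderEmbOfFin rfl) := by
    rw [Finset.range_orderEmbOfFin]
    exact hi
  exact this

/-- The code of `(S, Z)` at the `j`-th slot. [port lint docstring] -/
theorem code_apply_index {S : Finset (Fin n)} (hS : S.card ≤ w) (Z : Finset (Fin n)) (j : Fin S.card) :
    code w S Z ⟨j, lt_of_lt_of_le j.2 hS⟩ =
      some (S.orderEmbOfFin rfl j, decide (S.orderEmbOfFin rfl j ∈ Z)) := by
  unfold code
  rw [dif_pos (show ((⟨j, lt_of_lt_of_le j.2 hS⟩ : Fin w) : ℕ) < S.card from j.2)]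

/-- ★ agreement with the code of `(S, Z)` is the event `b ∩ S = Z`. -/
theorem agree_code_iff {S Z : Finset (Fin n)} (hS : S.card ≤ w) (hZ : Z ⊆ S) (b : Finset (Fin n)) :
    Agree w b (code w S Z) ↔ b ∩ S = Z := by
  constructor
  · intro h
    ext i
    rw [Finset.mem_inter]
    constructor
    · rintro ⟨hib, hiS⟩
      obtain ⟨j, hj⟩ := exists_index_of_mem hiS
      have hk := h _ _ (code_apply_index w hS Z j)
      rw [hj] at hk
      simpa [hib] using hk
    · intro hiZ
      have hiS := hZ hiZ
      obtain ⟨j, hj⟩ := exists_index_of_mem hiS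
      have hk := h _ _ (code_apply_index w hS Z j)
      rw [hj] at hk
      exact ⟨by simpa [hiZ] using hk, hiS⟩
  · rintro rfl k p hp
    unfold code at hp
    split_ifs at hp with hk
    obtain rfl := Option.some_inj.1 hp
    have hmem : S.orderEmbOfFin rfl ⟨k, hk⟩ ∈ S := Finset.orderEmbOfFin_mem S rfl _
    simp [Finset.mem_inter, hmem]

/-- the column factor: the indicator of agreement. -/
def V (b : Finset (Fin n)) (f : Slot n w) : ℝ := by
  classical
  exact if Agree w b f then 1 else 0

/-- `V ≥ 0`. [port lint docstring] -/
theorem V_nonneg (b : Finset (Fin n)) (f : Slot n w) : 0 ≤ V w b f := by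
  unfold V
  split_ifs <;> norm_num

/-- `V` at the code of `(S, Z)`. [port lint docstring] -/
theorem V_code {S Z : Finset (Fin n)} (hS : S.card ≤ w) (hZ : Z ⊆ S) (b : Finset (Fin n)) :
    V w b (code w S Z) = if b ∩ S = Z then 1 else 0 := by
  unfold V
  by_cases h : Agree w b (code w S Z)
  · rw [if_pos h, if_pos ((agree_code_iff w hS hZ b).1 h)]
  · rw [if_neg h, if_neg (mt (agree_code_iff w hS hZ b).2 h)]

variable (F : RowFamily)

/-- the row factor: the row's slack values on the patterns of its junta set `S`. -/
def U (S : F.A n → Finset (Fin n)) (a : F.A n) (f : Slot n w) : ℝ := by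
  classical
  exact ∑ Z ∈ (S a).powerset, if code w (S a) Z = f then F.β n a - F.ρ n a ⬝ᵥ udPt Z else 0

/-- `U ≥ 0`. [port lint docstring] -/
theorem U_nonneg (S : F.A n → Finset (Fin n)) (a : F.A n) (f : Slot n w) : 0 ≤ U w F S a f := by
  classical
  unfold U
  refine Finset.sum_nonneg fun Z _ => ?_
  split_ifs
  · exact slack_nonneg F a Z
  · exact le_rfl

/-- ★ the junta factorisation: `Σ_f U_a(f) V_b(f) = slack_a(b ∩ S_a)`. -/
theorem sum_U_mul_V (S : F.A n → Finset (Fin n)) (hS : ∀ a, (S a).card ≤ w) (a : F.A n) (b : Finset (Fin n)) :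
    ∑ f, U w F S a f * V w b f = F.β n a - F.ρ n a ⬝ᵥ udPt (b ∩ S a) := by
  classical
  calc ∑ f, U w F S a f * V w b f
      = ∑ f, ∑ Z ∈ (S a).powerset,
          (if code w (S a) Z = f then F.β n a - F.ρ n a ⬝ᵥ udPt Z else 0) * V w b f := by
        refine Finset.sum_congr rfl fun f _ => ?_
        unfold U
        rw [Finset.sum_mul]
    _ = ∑ Z ∈ (S a).powerset, ∑ f,
          (if code w (S a) Z = f then F.β n a - F.ρ n a ⬝ᵥ udPt Z else 0) * V w b f := Finset.sum_comm
    _ = ∑ Z ∈ (S a).powerset, (F.β n a - F.ρ n a ⬝ᵥ udPt Z) * V w b (code w (S a) Z) := by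
        refine Finset.sum_congr rfl fun Z _ => ?_
        simp only [ite_mul, zero_mul]
        rw [Finset.sum_ite_eq]
        simp
    _ = ∑ Z ∈ (S a).powerset, (if b ∩ S a = Z then F.β n a - F.ρ n a ⬝ᵥ udPt Z else 0) := by
        refine Finset.sum_congr rfl fun Z hZ => ?_
        rw [V_code w (hS a) (Finset.mem_powerset.1 hZ) b]
        split_ifs <;> simp
    _ = F.β n a - F.ρ n a ⬝ᵥ udPt (b ∩ S a) := by
        rw [Finset.sum_ite_eq]
        rw [if_pos (Finset.mem_powerset.2 Finset.inter_subset_right)]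

/-- ★★ a `w`-junta family has a cheap COR-slack block: `(2n+1)^w` slots. -/
theorem cheapCorSlack_of_junta (n w : ℕ) (F : RowFamily)
    (hJ : ∀ a : F.A n, ∃ S : Finset (Fin n), S.card ≤ w ∧
      ∀ b, F.β n a - F.ρ n a ⬝ᵥ udPt b = F.β n a - F.ρ n a ⬝ᵥ udPt (b ∩ S)) :
    CheapCorSlack F n ((2 * n + 1) ^ w) := by
  classical
  choose S hS hJ' using hJ
  rw [← card_slot n w]
  exact cheapCorSlack_of_fintype F n (U w F S) (V w) (U_nonneg w F S) (V_nonneg w)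
    (fun a b => by rw [sum_U_mul_V w F S hS a b]; exact hJ' a b)

end Junta

/-- budget arithmetic: `(2n+1)^{(log₂ n)^d} ≤ T (d+2) n` for every `n`. -/
theorem junta_budget (n d : ℕ) : (2 * n + 1) ^ (Nat.log 2 n ^ d) ≤ T (d + 2) n := by
  unfold T
  set L := Nat.log 2 n with hL
  have h0 : n < 2 ^ (L + 1) := Nat.lt_pow_succ_log_self one_lt_two n
  have h1 : 2 * n + 1 ≤ 2 ^ (L + 2) := by
    have : 2 ^ (L + 2) = 2 * 2 ^ (L + 1) := by ring
    omega
  have h2 : (L + 2) * L ^ d ≤ (L + (d + 2)) ^ (d + 2) := by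
    have e1 : L ^ d ≤ (L + (d + 2)) ^ d := Nat.pow_le_pow_left (by omega) d
    have e2 : (L + 2) * (L + (d + 2)) ^ d ≤ (L + (d + 2)) * (L + (d + 2)) ^ d :=
      Nat.mul_le_mul_right _ (by omega)
    have e3 : (L + (d + 2)) * (L + (d + 2)) ^ d = (L + (d + 2)) ^ (d + 1) := by ring
    have e4 : (L + (d + 2)) ^ (d + 1) ≤ (L + (d + 2)) ^ (d + 2) :=
      Nat.pow_le_pow_right (by omega) (by omega)
    calc (L + 2) * L ^ d ≤ (L + 2) * (L + (d + 2)) ^ d := Nat.mul_le_mul_left _ e1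
      _ ≤ (L + (d + 2)) * (L + (d + 2)) ^ d := e2
      _ = (L + (d + 2)) ^ (d + 1) := e3
      _ ≤ (L + (d + 2)) ^ (d + 2) := e4
  calc (2 * n + 1) ^ (L ^ d) ≤ (2 ^ (L + 2)) ^ (L ^ d) := Nat.pow_le_pow_left h1 _
    _ = 2 ^ ((L + 2) * L ^ d) := by rw [← pow_mul]
    _ ≤ 2 ^ ((L + (d + 2)) ^ (d + 2)) := Nat.pow_le_pow_right (by norm_num) h2

/-- ★★★ **JUNTA BARRIER.**  A located family whose rows are, from some order on, `(log₂ n)^d`-juntas in `𝟙_b` (their COR-slack depends on `b`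
only through `b ∩ S_a`, `|S_a| ≤ (log₂ n)^d`) has a FALSE law — whatever its right-hand sides. -/
theorem law_false_of_junta (F : RowFamily) (d n₁ : ℕ)
    (hJ : ∀ n, n₁ ≤ n → ∀ a : F.A n, ∃ S : Finset (Fin n), S.card ≤ Nat.log 2 n ^ d ∧
      ∀ b, F.β n a - F.ρ n a ⬝ᵥ udPt b = F.β n a - F.ρ n a ⬝ᵥ udPt (b ∩ S)) : ¬ F.Law :=
  law_false_of_cheap_corSlack F (d + 2) fun n₀ =>
    ⟨max n₀ n₁, le_max_left _ _, (2 * max n₀ n₁ + 1) ^ (Nat.log 2 (max n₀ n₁) ^ d),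
      Nat.one_le_pow _ _ (by omega), junta_budget _ _,
      cheapCorSlack_of_junta _ _ F (hJ _ (le_max_right _ _))⟩

/-! ## §4 Instance: sparse functionals `udRow a + flat W` at small cliques -/

section Sparse
variable {n : ℕ}

/-- `⟨udRow a, x_b⟩` depends on `b` only through `b ∩ S` when `a ⊆ S`. -/
theorem udRow_dotProduct_udPt_inter {a S : Finset (Fin n)} (haS : a ⊆ S) (b : Finset (Fin n)) :
    udRow a ⬝ᵥ udPt b = udRow a ⬝ᵥ udPt (b ∩ S) := by
  have h1 := (ud_data n).2.2.1 a b
  have h2 := (ud_data n).2.2.1 a (b ∩ S)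
  have hab : a ∩ (b ∩ S) = a ∩ b := by
    ext i
    simp only [Finset.mem_inter]
    constructor
    · rintro ⟨hia, hib, -⟩; exact ⟨hia, hib⟩
    · rintro ⟨hia, hib⟩; exact ⟨hia, hib, haS hia⟩
  rw [hab] at h2
  linarith

/-- The indicator of `b` at `i ∈ S` only sees `b ∩ S`. [port lint docstring] -/
theorem udInd_inter_of_mem {S : Finset (Fin n)} {i : Fin n} (hi : i ∈ S) (b : Finset (Fin n)) :
    udInd (b ∩ S) i = udInd b i := by
  unfold udInd bvec
  simp [Finset.mem_inter, hi]

/-- `⟨flat W, x_b⟩` depends on `b` only through `b ∩ S` when the vertex support of `W` lies in `S`. -/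
theorem flat_dotProduct_udPt_inter {S : Finset (Fin n)} (W : Matrix (Fin n) (Fin n) ℝ)
    (hW : ∀ i j, W i j ≠ 0 → i ∈ S ∧ j ∈ S) (b : Finset (Fin n)) :
    flat W ⬝ᵥ udPt b = flat W ⬝ᵥ udPt (b ∩ S) := by
  unfold udPt
  rw [Literature.Combinatorics.Optimization.FixedSizePsdRank.flat_dotProduct_vecOuter,
    Literature.Combinatorics.Optimization.FixedSizePsdRank.flat_dotProduct_vecOuter]
  refine Finset.sum_congr rfl fun i _ => Finset.sum_congr rfl fun j _ => ?_
  by_cases h : W i j = 0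
  · simp [h]
  · obtain ⟨hi, hj⟩ := hW i j h
    rw [udInd_inter_of_mem hi, udInd_inter_of_mem hj]

/-- ★★★ **SPARSE ROWS AT SMALL CLIQUES ARE TOO POOR.**  If, from some order on, every row functional of `F` is `udRow a + flat W` with the
clique `a` and the vertex support of the tilt `W` inside a set of at most `(log₂ n)^d` coordinates, the located law of `F` is FALSE —
for ANY scales and ANY (valid) right-hand sides.  In particular every exact sparse-tilt alphabet `L_{s,η}` anchored at cliques of size
`≤ polylog` with `s ≤ polylog` is dead on arrival. -/
theorem law_false_of_sparse_rows (F : RowFamily) (d n₁ : ℕ)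
    (h : ∀ n, n₁ ≤ n → ∀ a : F.A n, ∃ S : Finset (Fin n), S.card ≤ Nat.log 2 n ^ d ∧
      ∃ (a₀ : Finset (Fin n)) (W : Matrix (Fin n) (Fin n) ℝ), a₀ ⊆ S ∧ (∀ i j, W i j ≠ 0 → i ∈ S ∧ j ∈ S) ∧
        F.ρ n a = udRow a₀ + flat W) : ¬ F.Law := by
  refine law_false_of_junta F d n₁ fun n hn a => ?_
  obtain ⟨S, hS, a₀, W, ha₀, hW, hρ⟩ := h n hn a
  refine ⟨S, hS, fun b => ?_⟩
  rw [hρ, add_dotProduct, add_dotProduct, udRow_dotProduct_udPt_inter ha₀ b, flat_dotProduct_udPt_inter W hW b]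

end Sparse

/-! ## §5 The argmax-class extraction — the enemy constraint behind the point passenger

In ANY instance of the law's hypothesis (passenger `q`, located maxima `m`, nonnegative factorisation `(U, V)` of the located slack
through `Option (Fin r)`), the column block `(·, j)` restricted to the ARGMAX CLASS `{a : ⟨ρ_a, q_j⟩ = m_a}` of the generator `j` IS the
family's own COR-slack block on that class — so the own block of every argmax class factors through the same `r + 1` slots.  The point
passenger is the case of a single class (all rows).  Read as an ENEMY CONSTRAINT for the surviving design cell (rule v3): a passenger
refuting a law whose own block is expensive must SHATTER the rows into argmax classes with cheap own blocks (for `Q♮` against the clique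
rows the classes are `{P, ∅}`, ✓ p671347) and pay the off-class differences `m_a − ⟨ρ_a, q_j⟩ ≥ 0` with the remaining budget. -/

section Argmax
variable {n K r : ℕ}

/-- ★ on the argmax class of `j`, the located slack at the columns `(b, j)` is the own COR-slack. -/
theorem ownBlock_of_argmax (F : RowFamily) (q : Fin (K + 1) → (Fin (n * n) → ℝ)) (m : F.A n → ℝ)
    (U : F.A n → Option (Fin r) → ℝ) (V : Finset (Fin n) × Fin (K + 1) → Option (Fin r) → ℝ)
    (hfac : ∀ a b j, (F.β n a + m a) - F.ρ n a ⬝ᵥ (udPt b + q j) = ∑ i, U a i * V (b, j) i)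
    (j : Fin (K + 1)) (a : F.A n) (ha : F.ρ n a ⬝ᵥ q j = m a) (b : Finset (Fin n)) :
    F.β n a - F.ρ n a ⬝ᵥ udPt b = ∑ i, U a i * V (b, j) i := by
  have h := hfac a b j
  rw [dotProduct_add] at h
  linarith

/-- the own COR-slack block of a row class `A` factors nonnegatively through `Option (Fin r)`. -/
def CheapOn (F : RowFamily) (n : ℕ) (A : Set (F.A n)) (r : ℕ) : Prop :=
  ∃ (U : F.A n → Option (Fin r) → ℝ) (V : Finset (Fin n) → Option (Fin r) → ℝ),
    (∀ a i, 0 ≤ U a i) ∧ (∀ b i, 0 ≤ V b i) ∧ ∀ a ∈ A, ∀ b, F.β n a - F.ρ n a ⬝ᵥ udPt b = ∑ i, U a i * V b i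

/-- `CheapCorSlack` is `CheapOn` the class of all rows. -/
theorem cheapCorSlack_iff_cheapOn_univ (F : RowFamily) (n r : ℕ) : CheapCorSlack F n r ↔ CheapOn F n Set.univ r := by
  constructor
  · rintro ⟨U, V, hU, hV, h⟩; exact ⟨U, V, hU, hV, fun a _ b => h a b⟩
  · rintro ⟨U, V, hU, hV, h⟩; exact ⟨U, V, hU, hV, fun a b => h a (Set.mem_univ a) b⟩

/-- ★★ **ENEMY CONSTRAINT.**  Every argmax class of every instance of the law's hypothesis is cheap with the instance's own budget `r`. -/
theorem cheapOn_argmax_class (F : RowFamily) (q : Fin (K + 1) → (Fin (n * n) → ℝ)) (m : F.A n → ℝ)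
    (U : F.A n → Option (Fin r) → ℝ) (V : Finset (Fin n) × Fin (K + 1) → Option (Fin r) → ℝ)
    (hU : ∀ a i, 0 ≤ U a i) (hV : ∀ p i, 0 ≤ V p i)
    (hfac : ∀ a b j, (F.β n a + m a) - F.ρ n a ⬝ᵥ (udPt b + q j) = ∑ i, U a i * V (b, j) i)
    (j : Fin (K + 1)) : CheapOn F n {a | F.ρ n a ⬝ᵥ q j = m a} r :=
  ⟨U, fun b => V (b, j), hU, fun b i => hV _ _, fun a ha b => ownBlock_of_argmax F q m U V hfac j a ha b⟩

/-- consequently: if some generator's argmax class is NOT cheap with budget `r`, this instance cannot refute the law at budget `r`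
(the law's conclusion `T c n < r` is not needed — the hypothesis itself fails). -/
theorem no_instance_of_rich_class (F : RowFamily) (q : Fin (K + 1) → (Fin (n * n) → ℝ)) (m : F.A n → ℝ) (j : Fin (K + 1))
    (hrich : ¬ CheapOn F n {a | F.ρ n a ⬝ᵥ q j = m a} r)
    (U : F.A n → Option (Fin r) → ℝ) (V : Finset (Fin n) × Fin (K + 1) → Option (Fin r) → ℝ)
    (hU : ∀ a i, 0 ≤ U a i) (hV : ∀ p i, 0 ≤ V p i) :
    ¬ ∀ a b j, (F.β n a + m a) - F.ρ n a ⬝ᵥ (udPt b + q j) = ∑ i, U a i * V (b, j) i :=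
  fun hfac => hrich (cheapOn_argmax_class F q m U V hU hV hfac j)

end Argmax

end Summit.ValiantsHypothesis.ValiantsHypothesis.Theorems.FifoMatching.PovertyBarrier
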